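import Summits.CriticalPhenomena.PercolationContinuityZ3.Theorems.Transplant.KNCells2Cover
import Summits.CriticalPhenomena.PercolationContinuityZ3.Theorems.Transplant.KNCellsStepsDefs
import HarnessLib

/-!
# F8 (generic, LAG-1 ANCHORS), part 9 — the face-prefix geometry (input (I3) of `fail_bound₂`) after a `Valid₂` history, from a level
# geometry `LevelGeom` (KN p. 31 "to hit `M_x` via `H_{v,x}` you must pass through all the `F^j`", for an anchored cell geometry with a LEVEL FUNCTION; cover at the stored
# `arr` anchors, general anchors `(a, a')`; self-contained — supersedes the queued `KNCellsFacePrefix`)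

builds on p205010 (kernel theorem, internal audit signed; external expert review pending) — nothing in this file uses p205010.
Lane `prim-bschramm`, seat `prim-bschramm-p2`; helper file (`--supports stmt-CriticalPhenomena-4575`).  Design F8-DESIGN.md §7.

* `Sep`, `LevelData`, `LevelGeom` (the instance-checkable level geometry: 1-Lipschitz level along edges, `Q_v` and the near corridor at levels
  `≤ ℓQ < L j`, stubs/faces as sublevel/level sets, far faces (`j+1 ≤ K`) and targets beyond, separations of `Btw`/cells/zones from `Efar`);
* `Valid₂.sep_Efar`, **`exists_face_prefix₂`**, **`reach_subset_Aface₂`**, **`Aface_subset_Aface₂`**,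
  `facePrefix₂_P1`, `facePrefix₂_P2` (the hypotheses `hP1`/`hP2` of `fail_bound₂` at the history anchors).
[cite: KozmaNitzan2024, §4 p. 31 (Step IV) — the ℤ^d model] [cite: GrimmettPercolation1999, §7.2]
-/

noncomputable section

open MeasureTheory ProbabilityTheory
open scoped ENNReal Classical

namespace Summit.CriticalPhenomena.PercolationContinuityZ3.Theorems

namespace Transplant

namespace KNCells

open Literature.Probability.Percolation Literature.Probability.LatticeModels SimpleGraph GadgetSystem ProbeHistory HSiteScheme Contour

variable {V : Type*} [DecidableEq V]

/-! ## §1 Separation, level data, the level geometry -/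

/-- **Separated vertex sets**: no common vertex and no edge of `G` between them (KN's `Sep`). [folklore] -/
def Sep (G : SimpleGraph V) (X Y : Finset V) : Prop := ∀ a ∈ X, ∀ b ∈ Y, a ≠ b ∧ ¬G.Adj a b

omit [DecidableEq V] in
/-- A separated pair has no common vertex. [folklore] -/
theorem Sep.not_mem {G : SimpleGraph V} {X Y : Finset V} (h : Sep G X Y) {a : V} (ha : a ∈ X) : a ∉ Y :=
  fun hb => (h a ha a hb).1 rfl

/-- **Level data** of an anchored cell geometry: an integer level on the vertices for each (departure anchor, macro-vertex, direction) — KN: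
`σ (y_a - cen_v,a)`, the signed coordinate along `du` — the levels `L j` of the faces `F^j` (KN: `5r + 10sj`) and a bound `ℓQ` for the levels
of `Q_v` and of the near part of the corridor (KN: `5r`). [cite: KozmaNitzan2024, §4 pp. 26, 30–31] -/
structure LevelData (V A : Type*) where
  /-- the level of a vertex seen from `(a', v, δ)` -/
  lev : A → Site 2 → MDir → V → ℤ
  /-- the level of the face `F^j` -/
  L : ℕ → ℤ
  /-- the levels of `Q_v` and of `H_{v,x} \ E_{v,x}` are `≤ ℓQ` -/
  ℓQ : ℤ

/-- **The level geometry** (all that Step IV's path argument uses, KN p. 31): levels are 1-Lipschitz along edges of `G`; `Q_v` and the near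
part of the corridor lie at levels `≤ ℓQ < L j` (`j ≥ 1`); inside the corridor, level `≤ L j` means the stub `H^j` and level `= L j` means the
face `F^j`; the next face (level `≤ K`) and the target cube lie in `E_{v,x}` strictly beyond; `E_{w,v}`'s between-part, the cells of macro-vertices `≠ v, x`
and all their zones are separated from `E_{v,x}` (whatever the anchors). [cite: KozmaNitzan2024, §4 pp. 26, 30–31] -/
structure LevelGeom {A : Type*} (G : SimpleGraph V) (Γ : CellGeom V A) (FD : FaceData V A) (LD : LevelData V A) : Prop where
  adj_le : ∀ a' v δ y z, G.Adj y z → LD.lev a' v δ z ≤ LD.lev a' v δ y + 1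
  lev_Q : ∀ a a' v δ, a' ∈ Γ.anchSet a v → ∀ y ∈ Γ.Q a v, LD.lev a' v δ y ≤ LD.ℓQ
  lev_Hfull : ∀ a' v δ, ∀ y ∈ FD.Hfull a' v δ, y ∉ Γ.Efar a' v δ → LD.lev a' v δ y ≤ LD.ℓQ
  ℓQ_lt : ∀ j, 1 ≤ j → LD.ℓQ < LD.L j
  mem_Stub : ∀ a' v δ j, 1 ≤ j → j ≤ Γ.K → ∀ y ∈ FD.Hfull a' v δ, LD.lev a' v δ y ≤ LD.L j → y ∈ Γ.Stub a' v δ j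
  mem_Face : ∀ a' v δ j, 1 ≤ j → j ≤ Γ.K → ∀ y ∈ FD.Hfull a' v δ, LD.lev a' v δ y = LD.L j → y ∈ FD.Face a' v δ j
  Face_far : ∀ a' v δ j, j + 1 ≤ Γ.K → ∀ t ∈ FD.Face a' v δ (j + 1), t ∈ Γ.Efar a' v δ ∧ LD.L j + 1 ≤ LD.lev a' v δ t
  M_far : ∀ a' v δ, ∀ t ∈ Γ.M a' (v + stepVec δ), t ∈ Γ.Efar a' v δ ∧ LD.L Γ.K + 1 ≤ LD.lev a' v δ t
  Btw_sep_Efar : ∀ a a' w δw du, du ≠ rev δw → Sep G (Γ.Btw a w δw) (Γ.Efar a' (w + stepVec δw) du)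
  Cell_sep_Efar : ∀ b a' u v δ, u ≠ v → u ≠ v + stepVec δ → Sep G (Γ.Cell b u) (Γ.Efar a' v δ)
  Zone_sep_Efar : ∀ b a' u δ' v δ, u ≠ v → u ≠ v + stepVec δ → Sep G (Γ.Zone b u δ') (Γ.Efar a' v δ)

namespace KSchA

variable {A : Type*} {G : SimpleGraph V} [G.LocallyFinite] {S : KSchA V A} {FD : FaceData V A} {LD : LevelData V A}
variable (hL : LevelGeom G S.Γ FD LD) (hSt : StepsGeom S.Γ FD)
variable {h : ProbeHistory V} {e : Site 2 × MDir} (hV : S.Valid₂ G h e) {a a' : A} {du : MDir} (hdu : du ∈ S.onward G h (tgt e))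
include hL hV hdu

/-! ## §2 The explored region is separated from `E_{v,x}` -/

/-- **After a valid history the explored region is separated from `E_{v,x}`** (any anchor): it is covered by the cells and zones of determined
macro-vertices, all `≠ v, x`. [cite: KozmaNitzan2024, §4 p. 26 ((29)), p. 31] -/
theorem Valid₂.sep_Efar : Sep G (S.Vx G h) (S.Γ.Efar a' (tgt e) du) := by
  intro y hy b hb
  obtain ⟨det, hv, hx, hsub⟩ := hV.cover
  have hy' := hsub (Finset.mem_coe.2 hy)
  simp only [CellGeom.Cover, Set.mem_iUnion, Set.mem_union, exists_prop, Finset.mem_coe] at hy'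
  obtain ⟨u, hu, h' | ⟨δ', h'⟩⟩ := hy'
  · have huv : u ≠ tgt e := fun h'' => hv (h'' ▸ hu)
    have hux : u ≠ tgt e + stepVec du := fun h'' => hx du hdu (h'' ▸ hu)
    exact hL.Cell_sep_Efar _ _ _ _ _ huv hux y h' b hb
  · have huv : u ≠ tgt e := fun h'' => hv (h'' ▸ hu)
    have hux : u ≠ tgt e + stepVec du := fun h'' => hx du hdu (h'' ▸ hu)
    exact hL.Zone_sep_Efar _ _ _ _ _ _ huv hux y h' b hb

/-! ## §3 Crossing the faces -/

omit [G.LocallyFinite] hV hdu in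
/-- A corridor point not beyond level `L` has level `≤ L` (`ℓQ ≤ L`). [folklore] -/
theorem lev_le_of_mem_Hfull_of_not_past₂ {y : V} (hy : y ∈ FD.Hfull a' (tgt e) du) {Lv : ℤ} (hLv : LD.ℓQ ≤ Lv)
    (hR : ¬(y ∈ S.Γ.Efar a' (tgt e) du ∧ Lv + 1 ≤ LD.lev a' (tgt e) du y)) : LD.lev a' (tgt e) du y ≤ Lv := by
  by_contra hlt
  push Not at hlt
  by_cases hyE : y ∈ S.Γ.Efar a' (tgt e) du
  · exact hR ⟨hyE, by omega⟩
  · have := hL.lev_Hfull _ _ _ y hy hyE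
    omega

/-- **To reach beyond the level of `F^j` through the corridor one crosses `F^j`** (KN p. 31): an open path inside `Rgn' ⊆ E_i ∪ E_{w,v} ∪ H_{v,x}`,
using edges of `G`, from the root to a point of `E_{v,x}` of level `> L j` (`1 ≤ j ≤ K`, departure anchor admissible) has an initial segment
inside `E_i ∪ E_{w,v} ∪ H^j_{v,x}` ending on `F^j_{v,x}`. [cite: KozmaNitzan2024, §4 p. 31 (Step IV)] -/
theorem exists_face_prefix₂ (ha' : a' ∈ S.Γ.anchSet a (tgt e)) {G' : SimpleGraph V} {Rgn' : Set V}
    (hRgn : Rgn' ⊆ ↑(S.Vx G h ∪ S.Γ.Ewv a e.1 e.2 ∪ FD.Hfull a' (tgt e) du))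
    (hG : ∀ y ∈ Rgn', ∀ z ∈ Rgn', G'.Adj y z → G.Adj y z)
    {z : V} (hz : z ∈ S.Γ.Efar a' (tgt e) du) {j : ℕ} (hj1 : 1 ≤ j) (hjK : j ≤ S.Γ.K)
    (hlev : LD.L j + 1 ≤ LD.lev a' (tgt e) du z) (hp : PathIn G' Rgn' S.Γ.root z) :
    ∃ y ∈ FD.Face a' (tgt e) du j,
      PathIn G' (↑(S.Vx G h ∪ S.Γ.Ewv a e.1 e.2 ∪ S.Γ.Stub a' (tgt e) du j) : Set V) S.Γ.root y := by
  set v := tgt e with hv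
  set Lv : ℤ := LD.L j with hLvdef
  have hQL : LD.ℓQ < Lv := hL.ℓQ_lt j hj1
  set Past : Set V := {y | y ∈ S.Γ.Efar a' v du ∧ Lv + 1 ≤ LD.lev a' v du y} with hPast
  have hsep := Valid₂.sep_Efar hL hV hdu (a' := a')
  have h0 : S.Γ.root ∈ Pastᶜ := fun h0 => hsep.not_mem hV.root_mem h0.1
  have hzP : z ∉ Pastᶜ := fun h' => h' ⟨hz, hlev⟩
  obtain ⟨y, b, hy, hb, hbR, hyb, hpy⟩ := hp.exit h0 hzP
  simp only [Set.mem_compl_iff, not_not] at hb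
  obtain ⟨hbE, hbl⟩ := hb
  have hyR : y ∈ Rgn' := hpy.right_mem.2
  have hadj : G.Adj y b := hG y hyR b hbR hyb
  have hla : LD.lev a' v du b ≤ LD.lev a' v du y + 1 := hL.adj_le _ _ _ _ _ hadj
  -- where is `y`?  Not explored, not in `E_{w,v}`: in the corridor, at level exactly `L j`
  have hyH : y ∈ FD.Hfull a' v du ∧ LD.lev a' v du y = Lv := by
    rcases Finset.mem_union.1 (hRgn hyR) with hy' | hy'
    · rcases Finset.mem_union.1 hy' with hy'' | hy''
      · exact absurd hadj (hsep y hy'' b hbE).2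
      · rcases Finset.mem_union.1 hy'' with hy3 | hy3
        · -- `y ∈ Btw a w δw`: separated from `E_{v,x}`
          have := hL.Btw_sep_Efar a a' e.1 e.2 du (du_ne_rev₂ hV hdu)
          exact absurd hadj (this y hy3 b hbE).2
        · -- `y ∈ Q_v`: level `≤ ℓQ`, but `b` has level `≥ L j + 1 ≥ ℓQ + 2`
          exfalso
          have := hL.lev_Q _ _ _ du ha' y hy3
          omega
    · have hyl : LD.lev a' v du y ≤ Lv := lev_le_of_mem_Hfull_of_not_past₂ hL hy' hQL.le hy
      exact ⟨hy', le_antisymm hyl (by omega)⟩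
  obtain ⟨hyHf, hyL⟩ := hyH
  refine ⟨y, hL.mem_Face _ _ _ _ hj1 hjK y hyHf hyL, hpy.mono ?_⟩
  -- the complement of `Past` inside `Rgn'` lies in `E_i ∪ E_{w,v} ∪ H^j`
  rintro y' ⟨hyP, hyR'⟩
  rcases Finset.mem_union.1 (hRgn hyR') with hy' | hy'
  · exact Finset.mem_coe.2 (Finset.mem_union_left _ hy')
  · have hyl : LD.lev a' v du y' ≤ Lv := lev_le_of_mem_Hfull_of_not_past₂ hL hy' hQL.le hyP
    exact Finset.mem_coe.2 (Finset.mem_union_right _ (hL.mem_Stub _ _ _ _ hj1 hjK y' hy' hyl))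

omit [G.LocallyFinite] hL hV hdu in
/-- On a lattice-only configuration the open edges inside the region are edges of `G`. [folklore] -/
theorem adj_of_lattOnly₂ {D : Finset V} {ω : BondConfig V} (hω : ω ∈ KNLevels.lattOnly G D) :
    ∀ y ∈ (↑D : Set V), ∀ z ∈ (↑D : Set V), (openGraph ω).Adj y z → G.Adj y z := by
  intro y hy z hz hadj
  rw [openGraph_adj] at hadj
  have hmem : s(y, z) ∈ KNLevels.pairsF D := by
    rw [← Finset.mem_coe, KNLevels.coe_pairsF]
    exact mk_mem_wireSet_iff.2 ⟨hy, hz, hadj.2⟩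
  exact (SimpleGraph.mem_edgeSet _).1 (hω s(y, z) hmem hadj.1)

/-- **`Reach ⊆ A'_{K-1}`** on lattice-only configurations (hypothesis `hP1` of `fail_bound`). [cite: KozmaNitzan2024, §4 p. 31 (Step IV)] -/
theorem reach_subset_Aface₂ (ha' : a' ∈ S.Γ.anchSet a (tgt e)) {ω : BondConfig V}
    (hω : ω ∈ KNLevels.lattOnly G (S.Vx G h ∪ S.Γ.Ewv a e.1 e.2 ∪ FD.Hfull a' (tgt e) du))
    (hR : ω ∈ S.Reach G FD h e a a' du) : ω ∈ S.Aface G FD h e a a' du (S.Γ.K - 1) := by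
  have hK1 : 1 ≤ S.Γ.K := S.Γ.hK
  have hKK : S.Γ.K - 1 + 1 = S.Γ.K := by omega
  simp only [Reach, Set.mem_iUnion, exists_prop, Finset.mem_coe] at hR
  obtain ⟨t, ht, hpath⟩ := hR
  rw [DCT16.mem_openConnIn_iff_pathIn] at hpath
  obtain ⟨htE, htl⟩ := hL.M_far _ _ _ t ht
  obtain ⟨y, hy, hpy⟩ := exists_face_prefix₂ hL hV hdu ha' subset_rfl (adj_of_lattOnly₂ hω) htE hK1 le_rfl htl hpath
  simp only [Aface, Set.mem_iUnion, exists_prop, Finset.mem_coe, hKK]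
  exact ⟨y, hy, DCT16.mem_openConnIn_iff_pathIn.2 hpy⟩

include hSt in
/-- **`A'_j ⊆ A'_{j-1}`** (`1 ≤ j < K`) on lattice-only configurations (hypothesis `hP2` of `fail_bound`). [cite: KozmaNitzan2024, §4 p. 31 (Step IV)] -/
theorem Aface_subset_Aface₂ (ha' : a' ∈ S.Γ.anchSet a (tgt e)) {j : ℕ} (hj1 : 1 ≤ j) (hjK : j < S.Γ.K) {ω : BondConfig V}
    (hω : ω ∈ KNLevels.lattOnly G (S.Vx G h ∪ S.Γ.Ewv a e.1 e.2 ∪ S.Γ.Stub a' (tgt e) du (j + 1)))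
    (hR : ω ∈ S.Aface G FD h e a a' du j) : ω ∈ S.Aface G FD h e a a' du (j - 1) := by
  have hjj : j - 1 + 1 = j := by omega
  simp only [Aface, Set.mem_iUnion, exists_prop, Finset.mem_coe] at hR
  obtain ⟨t, ht, hpath⟩ := hR
  rw [DCT16.mem_openConnIn_iff_pathIn] at hpath
  have hsub : (↑(S.Vx G h ∪ S.Γ.Ewv a e.1 e.2 ∪ S.Γ.Stub a' (tgt e) du (j + 1)) : Set V) ⊆
      ↑(S.Vx G h ∪ S.Γ.Ewv a e.1 e.2 ∪ FD.Hfull a' (tgt e) du) :=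
    Finset.coe_subset.2 (Finset.union_subset_union le_rfl (hSt.Stub_subset_Hfull _ _ _ _ (by omega)))
  obtain ⟨htE, htl⟩ := hL.Face_far _ _ _ j (by omega) t ht
  obtain ⟨y, hy, hpy⟩ := exists_face_prefix₂ hL hV hdu ha' hsub (adj_of_lattOnly₂ hω) htE hj1 hjK.le htl hpath
  simp only [Aface, Set.mem_iUnion, exists_prop, Finset.mem_coe, hjj]
  exact ⟨y, hy, DCT16.mem_openConnIn_iff_pathIn.2 hpy⟩

omit hV hdu in
/-- `hP1` of `fail_bound₂` at the history anchors `(α, β) = (arr v, dep v)`, discharged by a level geometry. [cite: KozmaNitzan2024, §4 p. 31 (Step IV)] -/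
theorem facePrefix₂_P1 {h : ProbeHistory V} {e : Site 2 × MDir} (hV : S.Valid₂ G h e) :
    ∀ du ∈ S.onward G h (tgt e), ∀ ω,
    ω ∈ KNLevels.lattOnly G (S.Vx G h ∪ S.Γ.Ewv (S.aOf₁ G h e) e.1 e.2 ∪ FD.Hfull (S.aOf₂ G h e) (tgt e) du) →
    ω ∈ S.Reach G FD h e (S.aOf₁ G h e) (S.aOf₂ G h e) du → ω ∈ S.Aface G FD h e (S.aOf₁ G h e) (S.aOf₂ G h e) du (S.Γ.K - 1) :=
  fun _ hdu _ hω hR => reach_subset_Aface₂ hL hV hdu hV.anch hω hR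

omit hV hdu in
include hSt in
/-- `hP2` of `fail_bound₂` at the history anchors, discharged by a level geometry. [cite: KozmaNitzan2024, §4 p. 31 (Step IV)] -/
theorem facePrefix₂_P2 {h : ProbeHistory V} {e : Site 2 × MDir} (hV : S.Valid₂ G h e) :
    ∀ du ∈ S.onward G h (tgt e), ∀ ω j,
    1 ≤ j → j < S.Γ.K → ω ∈ KNLevels.lattOnly G (S.Vx G h ∪ S.Γ.Ewv (S.aOf₁ G h e) e.1 e.2 ∪ S.Γ.Stub (S.aOf₂ G h e) (tgt e) du (j + 1)) →
    ω ∈ S.Aface G FD h e (S.aOf₁ G h e) (S.aOf₂ G h e) du j → ω ∈ S.Aface G FD h e (S.aOf₁ G h e) (S.aOf₂ G h e) du (j - 1) :=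
  fun _ hdu _ _ hj1 hjK hω hR => Aface_subset_Aface₂ hL hSt hV hdu hV.anch hj1 hjK hω hR

end KSchA

end KNCells

end Transplant

end Summit.CriticalPhenomena.PercolationContinuityZ3.Theorems

end
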